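import Summits.ValiantsHypothesis.ValiantsHypothesis.Theorems.LacunarySymmetroidMatrixDescartesCensusDoorA34SheetRankParity
import Summits.ValiantsHypothesis.ValiantsHypothesis.Theorems.LacunarySymmetroidMatrixDescartesCensusNewtonCone

/-!
# `MatrixDescartes` census — DOOR A at `(3,4)`: the TWISTED BLOCK ANATOMY of a hypothetical null-top eighteen — every block of slots (core / middle / top
# window), after the Euler twists that kill the other blocks, is a DESCARTES-SHARP fewnomial: `9 + 5 + 2`, in EVERY exponent chamber, with no window separation

HONEST FRAMING.  Object-search cell `pub-symmetroid`, engine seat `val-sym-eng-2` (g8); helper rows beside the registered strata line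
`Cruxes/DoorA34/Lines/strata.lean` on stmt-ValiantsHypothesis-19980 (`DoorA34 = PosRootLawAt 3 4 18`: OPEN, typed, never asserted here); second stub
`stub_nullTopCeiling` (`det S₃ = 0 ⇒ ≤ 17`).  The line's located/paper «window law» (HOME/DOOR-A34-ENG2G7-REPORT.md §2) reads a null-top count as
`core + 1 + γ_M + 1 + γ_T` and says an eighteen needs the middle window to carry `γ_M = 5` AND the top window `γ_T = 2` — but that reading assumes
window-separated roots (large `d₃`, wide band).  This file gives the RIGOROUS, CHAMBER-FREE form of that necessity, at the level of coefficients: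

* `exists_iterTwist` — iterated TWISTED ROLLE for an arbitrary real polynomial: for every finite set `U ⊂ ℝ` there is `g` with
  `coeff g n = (∏_{E∈U} (n − E))·coeff f n` and `Z₊(f) ≤ Z₊(g) + #U` (Rolle for `x^{−E} f`, `card_posRoots_le_card_posRoots_twist_succ` of …CensusTwistedRolle);
  `support_subset_sdiff_of_coeff_twists` — the twists kill exactly the exponents in `U`.
* **`twistedBlock_sharp_of_nullTop_eighteen`** — on the null-top sheet the `19` slots `s ≠ {3,3,3}` split by the multiplicity `c ∈ {0,1,2}` of the
  letter `3` into the CORE block (`c = 0`, `10` slots: `det G`), the MIDDLE block (`c = 1`, `6` slots: `tr(adj G·S₃)·X^{d₃}`) and the TOP block (`c = 2`,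
  `3` slots: `tr(adj S₃·G)·X^{2d₃}`).  If `det S₃ = 0` and the pencil has `18` distinct positive roots then, for each `c`, twisting away the other two blocks
  leaves a polynomial supported on the block's slot exponents with EXACTLY `#block − 1` distinct positive roots: the twisted core has `9`, the twisted
  middle window `5`, the twisted top window `2` — Descartes-sharp blocks, whatever the interleaving of the exponents (the twist of a slot is its
  coefficient times `∏ (σ(s) − σ(u))` over the killed slots `u`, an explicit non-zero integer weight depending on `d` only).
* **`twistedSubword_sharp_of_nullTop_eighteen`** / **`…_of_nullNull_seventeen`** — HEREDITY: the same for EVERY non-empty set of slots (any sub-word of a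
  Descartes-sharp word stays Descartes-sharp after twisting away the rest): e.g. the twisted upper tracking (middle ∪ top, `9` slots) has `8` roots and the
  twisted lower tracking (core ∪ middle, `16` slots) `15`; on the null-null sheet (`17` roots, `18` slots) every twisted sub-word `B` has `#B − 1`.
* **`topTrinomial_ineq_of_nullTop_eighteen`** — the top block made explicit: with `τ_e = tr(adj S₃·S_e)` (`e = 0,1,2`; `= c_{33e}`) and the weights
  `W_e = ∏_{u ∉ top block} (2d₃ + d_e − σ(u))`, the twisted top window `W₀τ₀X^{2d₃+d₀} + W₁τ₁X^{2d₃+d₁} + W₂τ₂X^{2d₃+d₂}` has two positive roots, hence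
  (trinomial lemma `trinomial_two_posRoots_le`) the MAGNITUDE inequality `(a+b)^{a+b}|W₀τ₀|^b|W₂τ₂|^a ≤ |W₁τ₁|^{a+b}aᵃbᵇ` (`a = d₁−d₀`, `b = d₂−d₁`):
  an eighteen needs the middle coefficient of the top window to DOMINATE — an open neighbourhood of `{tr(adj S₃·S₁) = 0}` carries no eighteen, quantitatively.
* `newton_cone_of_nullTop_eighteen` — bookkeeping: the kernel NEWTON CONE (…CensusNewtonCone, `newton_cone_coeff`) applies on the sheet (`19` monomials,
  `18` roots): all `969` triple inequalities on the weighted slot coefficients.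

Why it matters for the line: the sign level of the sheet is exhausted (atlas + chamber theorems); these are the first MAGNITUDE-level necessary conditions
stated for the generic sheet in the kernel, and the block form is exactly the «(γ_M, γ_T) = (5, 2)» prerequisite of the window law with the windows replaced
by twisted blocks (no `d₃ → ∞`, no band hypothesis).  Nothing here bounds `ζ_sym(3,4)`; `DoorA34` and the three stubs stay OPEN; registers unchanged; nothing on
`MatrixDescartes` (stmt-ValiantsHypothesis-18050) or `VP ≠ VNP` — VP≠VNP not moved.  [folklore] Rolle / Descartes counting / weighted AM–GM; no single source.
-/

-- `Summit.ValiantsHypothesis.ValiantsHypothesis.…` repeats a component by the D-0017 layout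
-- (single-conjunct summit), which the `dupNamespace` linter flags; the name is mandated.
set_option linter.dupNamespace false

namespace Summit.ValiantsHypothesis.ValiantsHypothesis.Theorems.LacunarySymmetroidMatrixDescartes.Census

open Polynomial Finset
open scoped BigOperators Polynomial Matrix

/-! ## 1. Iterated Euler twists of an arbitrary real polynomial -/

/-- **Iterated twisted Rolle (general polynomial).**  Killing the exponents `E ∈ U` by Euler twists `f ↦ X·f′ − E·f` multiplies each coefficient
`coeff f n` by `∏_{E∈U} (n − E)` and loses at most `#U` distinct positive roots. [folklore] -/
theorem exists_iterTwist (f : ℝ[X]) (U : Finset ℝ) :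
    ∃ g : ℝ[X], (∀ n : ℕ, g.coeff n = (∏ E ∈ U, ((n : ℝ) - E)) * f.coeff n) ∧
      (f.roots.toFinset.filter (fun x => 0 < x)).card ≤ (g.roots.toFinset.filter (fun x => 0 < x)).card + U.card := by
  induction U using Finset.induction_on with
  | empty => exact ⟨f, fun n => by simp, by simp⟩
  | insert E U hE ih =>
    obtain ⟨g, hg, hZ⟩ := ih
    refine ⟨X * derivative g - C E * g, fun n => ?_, ?_⟩
    · rw [coeff_X_mul_derivative_sub_C_mul, hg, Finset.prod_insert hE]; ring
    · have h := card_posRoots_le_card_posRoots_twist_succ g E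
      rw [Finset.card_insert_of_notMem hE]; omega

/-- The twists kill exactly the exponents in `U`: `supp g ⊆ supp f ∖ U`. [folklore] -/
theorem support_subset_sdiff_of_coeff_twists {f g : ℝ[X]} {U : Finset ℕ}
    (hg : ∀ n : ℕ, g.coeff n = (∏ E ∈ U.image (fun m : ℕ => (m : ℝ)), ((n : ℝ) - E)) * f.coeff n) :
    g.support ⊆ f.support \ U := by
  intro n hn
  rw [mem_support_iff, hg] at hn
  refine Finset.mem_sdiff.mpr ⟨mem_support_iff.mpr (right_ne_zero_of_mul hn), fun hnU => left_ne_zero_of_mul hn ?_⟩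
  exact Finset.prod_eq_zero (Finset.mem_image_of_mem _ hnU) (sub_self _)

/-! ## 2. The three twisted blocks of a null-top eighteen are Descartes-sharp -/

/-- Slot bookkeeping: for `c < 3`, the slots `s ≠ {3,3,3}` with `count 3 s ≠ c` and the slots with `count 3 s = c` partition the `19` sheet slots.
[folklore] -/
theorem card_slots_split (c : ℕ) (hc : c < 3) :
    (((Finset.univ : Finset (Sym (Fin 4) 3)).erase (Sym.replicate 3 3)).filter
        (fun s : Sym (Fin 4) 3 => Multiset.count 3 (s : Multiset (Fin 4)) ≠ c)).card
      + ((Finset.univ : Finset (Sym (Fin 4) 3)).filter (fun s : Sym (Fin 4) 3 => Multiset.count 3 (s : Multiset (Fin 4)) = c)).card = 19 := by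
  interval_cases c <;> decide

/-- For `c < 3` at most `16` slots are killed. [folklore] -/
theorem card_killSlots_le (c : ℕ) (hc : c < 3) :
    (((Finset.univ : Finset (Sym (Fin 4) 3)).erase (Sym.replicate 3 3)).filter
        (fun s : Sym (Fin 4) 3 => Multiset.count 3 (s : Multiset (Fin 4)) ≠ c)).card ≤ 16 := by
  interval_cases c <;> decide

/-- The top block: the three slots `{3,3,e}`, `e = 0,1,2`. [folklore] -/
theorem topSlots_eq :
    (Finset.univ : Finset (Sym (Fin 4) 3)).filter (fun s : Sym (Fin 4) 3 => Multiset.count 3 (s : Multiset (Fin 4)) = 2)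
      = {⟨{3, 3, 0}, by simp⟩, ⟨{3, 3, 1}, by simp⟩, ⟨{3, 3, 2}, by simp⟩} := by decide

/-- **TWISTED BLOCK ANATOMY OF A NULL-TOP EIGHTEEN.**  Let `det S₃ = 0` and suppose the pencil has `18` distinct positive roots.  Fix `c ∈ {0,1,2}` and
kill, by Euler twists, every slot exponent `σ(u)` of the slots `u ≠ {3,3,3}` with `count 3 u ≠ c`.  The result `g` — coefficients
`(∏_u (n − σ(u)))·coeff n`, supported on the exponents of the block `{s : count 3 s = c}` — has EXACTLY `#block − 1` distinct positive roots:
`9` for the core block (`c = 0`, `10` slots), `5` for the middle window (`c = 1`, `6` slots), `2` for the top window (`c = 2`, `3` slots). [folklore] -/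
theorem twistedBlock_sharp_of_nullTop_eighteen (d : Fin 4 → ℕ) (S : Fin 4 → Matrix (Fin 3) (Fin 3) ℝ) (h3 : (S 3).det = 0)
    (h18 : 18 ≤ ((Matrix.det (∑ l, ((X : ℝ[X]) ^ d l) • (S l).map C)).roots.toFinset.filter (fun t => 0 < t)).card)
    (c : ℕ) (hc : c < 3) :
    ∃ g : ℝ[X],
      (∀ n : ℕ, g.coeff n =
        (∏ E ∈ ((((Finset.univ : Finset (Sym (Fin 4) 3)).erase (Sym.replicate 3 3)).filter
            (fun s : Sym (Fin 4) 3 => Multiset.count 3 (s : Multiset (Fin 4)) ≠ c)).image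
            (fun s : Sym (Fin 4) 3 => ((s : Multiset (Fin 4)).map d).sum)).image (fun m : ℕ => (m : ℝ)), ((n : ℝ) - E))
          * (Matrix.det (∑ l, ((X : ℝ[X]) ^ d l) • (S l).map C)).coeff n) ∧
      g.support ⊆ ((Finset.univ : Finset (Sym (Fin 4) 3)).filter (fun s : Sym (Fin 4) 3 => Multiset.count 3 (s : Multiset (Fin 4)) = c)).image
          (fun s : Sym (Fin 4) 3 => ((s : Multiset (Fin 4)).map d).sum) ∧
      (g.roots.toFinset.filter (fun x => 0 < x)).card + 1
        = ((Finset.univ : Finset (Sym (Fin 4) 3)).filter (fun s : Sym (Fin 4) 3 => Multiset.count 3 (s : Multiset (Fin 4)) = c)).card := by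
  set σ : Sym (Fin 4) 3 → ℕ := fun s => ((s : Multiset (Fin 4)).map d).sum with hσ
  set K := ((Finset.univ : Finset (Sym (Fin 4) 3)).erase (Sym.replicate 3 3)).filter
    (fun s : Sym (Fin 4) 3 => Multiset.count 3 (s : Multiset (Fin 4)) ≠ c) with hK
  set B := (Finset.univ : Finset (Sym (Fin 4) 3)).filter (fun s : Sym (Fin 4) 3 => Multiset.count 3 (s : Multiset (Fin 4)) = c) with hB
  set f := Matrix.det (∑ l, ((X : ℝ[X]) ^ d l) • (S l).map C) with hf
  obtain ⟨g, hg, hZ⟩ := exists_iterTwist f ((K.image σ).image (fun m : ℕ => (m : ℝ)))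
  have hsupp : g.support ⊆ B.image σ := by
    intro n hn
    have hn' := support_subset_sdiff_of_coeff_twists hg hn
    rcases Finset.mem_sdiff.mp hn' with ⟨hnf, hnK⟩
    obtain ⟨s, hs, hsn⟩ := Finset.mem_image.mp (support_det_pencil_subset_of_nullTop d S h3 hnf)
    have hsK : s ∉ K := fun h => hnK (Finset.mem_image.mpr ⟨s, h, hsn⟩)
    have hsB : s ∈ B := by
      rw [hB, Finset.mem_filter]
      refine ⟨Finset.mem_univ _, ?_⟩
      by_contra hne
      exact hsK (by rw [hK, Finset.mem_filter]; exact ⟨hs, hne⟩)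
    exact Finset.mem_image.mpr ⟨s, hsB, hsn⟩
  have hsplit := card_slots_split c hc
  rw [← hK, ← hB] at hsplit
  have hU : ((K.image σ).image (fun m : ℕ => (m : ℝ))).card ≤ K.card := Finset.card_image_le.trans Finset.card_image_le
  have hK16 : K.card ≤ 16 := card_killSlots_le c hc
  have hg0 : g ≠ 0 := by
    intro h0
    rw [h0, roots_zero, Multiset.toFinset_zero, Finset.filter_empty, Finset.card_empty] at hZ
    omega
  have hlt := Literature.Computability.AlgebraicComplexity.card_roots_toFinset_filter_pos_lt_card_support hg0
  have hcard : g.support.card ≤ B.card := (Finset.card_le_card hsupp).trans Finset.card_image_le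
  refine ⟨g, hg, hsupp, ?_⟩
  omega

/-! ## 2b. Heredity: EVERY twisted sub-word of a null-top eighteen / null-null seventeen is Descartes-sharp -/

/-- **TWISTED SUB-WORDS OF A NULL-TOP EIGHTEEN ARE DESCARTES-SHARP.**  `det S₃ = 0`, `18` distinct positive roots, and ANY non-empty set `B` of slots
`s ≠ {3,3,3}`: killing the other slots by Euler twists leaves a polynomial supported on `σ(B)` with exactly `#B − 1` distinct positive roots.  (Blocks are the
case `B = {count 3 = c}`; `B =` middle ∪ top (`9` slots) is the twisted UPPER TRACKING `tr(adj G·S₃) + X^{d₃}·tr(adj S₃·G)` with `8` roots, `B =` core ∪ middle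
(`16` slots) the twisted LOWER TRACKING with `15` — the two trackings of the cancellation regime, HOME/DOOR-A34-ENG2G7-REPORT.md §3j.) [folklore] -/
theorem twistedSubword_sharp_of_nullTop_eighteen (d : Fin 4 → ℕ) (S : Fin 4 → Matrix (Fin 3) (Fin 3) ℝ) (h3 : (S 3).det = 0)
    (h18 : 18 ≤ ((Matrix.det (∑ l, ((X : ℝ[X]) ^ d l) • (S l).map C)).roots.toFinset.filter (fun t => 0 < t)).card)
    (B : Finset (Sym (Fin 4) 3)) (hB : B ⊆ (Finset.univ : Finset (Sym (Fin 4) 3)).erase (Sym.replicate 3 3)) (hB0 : B.Nonempty) :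
    ∃ g : ℝ[X],
      (∀ n : ℕ, g.coeff n =
        (∏ E ∈ ((((Finset.univ : Finset (Sym (Fin 4) 3)).erase (Sym.replicate 3 3)) \ B).image
            (fun s : Sym (Fin 4) 3 => ((s : Multiset (Fin 4)).map d).sum)).image (fun m : ℕ => (m : ℝ)), ((n : ℝ) - E))
          * (Matrix.det (∑ l, ((X : ℝ[X]) ^ d l) • (S l).map C)).coeff n) ∧
      g.support ⊆ B.image (fun s : Sym (Fin 4) 3 => ((s : Multiset (Fin 4)).map d).sum) ∧
      (g.roots.toFinset.filter (fun x => 0 < x)).card + 1 = B.card := by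
  set σ : Sym (Fin 4) 3 → ℕ := fun s => ((s : Multiset (Fin 4)).map d).sum with hσ
  set K := ((Finset.univ : Finset (Sym (Fin 4) 3)).erase (Sym.replicate 3 3)) \ B with hK
  set f := Matrix.det (∑ l, ((X : ℝ[X]) ^ d l) • (S l).map C) with hf
  obtain ⟨g, hg, hZ⟩ := exists_iterTwist f ((K.image σ).image (fun m : ℕ => (m : ℝ)))
  have hsupp : g.support ⊆ B.image σ := by
    intro n hn
    have hn' := support_subset_sdiff_of_coeff_twists hg hn
    rcases Finset.mem_sdiff.mp hn' with ⟨hnf, hnK⟩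
    obtain ⟨s, hs, hsn⟩ := Finset.mem_image.mp (support_det_pencil_subset_of_nullTop d S h3 hnf)
    have hsK : s ∉ K := fun h => hnK (Finset.mem_image.mpr ⟨s, h, hsn⟩)
    have hsB : s ∈ B := by
      by_contra hne
      exact hsK (by rw [hK, Finset.mem_sdiff]; exact ⟨hs, hne⟩)
    exact Finset.mem_image.mpr ⟨s, hsB, hsn⟩
  have hE : ((Finset.univ : Finset (Sym (Fin 4) 3)).erase (Sym.replicate 3 3)).card = 19 := by
    rw [Finset.card_erase_of_mem (Finset.mem_univ _), Finset.card_univ, Sym.card_sym_eq_choose]; decide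
  have hsplit : K.card + B.card = 19 := by
    have hBle : B.card ≤ 19 := hE ▸ Finset.card_le_card hB
    rw [hK, Finset.card_sdiff_of_subset hB, hE]
    omega
  have hU : ((K.image σ).image (fun m : ℕ => (m : ℝ))).card ≤ K.card := Finset.card_image_le.trans Finset.card_image_le
  have hBpos : 1 ≤ B.card := Finset.card_pos.mpr hB0
  refine ⟨g, hg, hsupp, ?_⟩
  rcases eq_or_ne g 0 with hg0 | hg0
  · rw [hg0, roots_zero, Multiset.toFinset_zero, Finset.filter_empty, Finset.card_empty] at hZ ⊢
    omega
  · have hlt := Literature.Computability.AlgebraicComplexity.card_roots_toFinset_filter_pos_lt_card_support hg0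
    have hcard : g.support.card ≤ B.card := (Finset.card_le_card hsupp).trans Finset.card_image_le
    omega

/-- **TWISTED SUB-WORDS OF A NULL-NULL SEVENTEEN ARE DESCARTES-SHARP** (the same heredity for `stub_nullNullCeiling`): `det S₀ = det S₃ = 0`, `17` distinct
positive roots, and any non-empty set `B` of slots `s ≠ {0,0,0}, {3,3,3}`: the twisted restriction to `B` has exactly `#B − 1` distinct positive roots
(e.g. the two-letter core block `{111,112,122,222}` twisted has `3`, each end window `{00x}` / `{x33}` twisted has `#B − 1`). [folklore] -/
theorem twistedSubword_sharp_of_nullNull_seventeen (d : Fin 4 → ℕ) (S : Fin 4 → Matrix (Fin 3) (Fin 3) ℝ) (h0 : (S 0).det = 0) (h3 : (S 3).det = 0)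
    (h17 : 17 ≤ ((Matrix.det (∑ l, ((X : ℝ[X]) ^ d l) • (S l).map C)).roots.toFinset.filter (fun t => 0 < t)).card)
    (B : Finset (Sym (Fin 4) 3)) (hB : B ⊆ ((Finset.univ : Finset (Sym (Fin 4) 3)).erase (Sym.replicate 3 3)).erase (Sym.replicate 3 0))
    (hB0 : B.Nonempty) :
    ∃ g : ℝ[X],
      (∀ n : ℕ, g.coeff n =
        (∏ E ∈ (((((Finset.univ : Finset (Sym (Fin 4) 3)).erase (Sym.replicate 3 3)).erase (Sym.replicate 3 0)) \ B).image
            (fun s : Sym (Fin 4) 3 => ((s : Multiset (Fin 4)).map d).sum)).image (fun m : ℕ => (m : ℝ)), ((n : ℝ) - E))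
          * (Matrix.det (∑ l, ((X : ℝ[X]) ^ d l) • (S l).map C)).coeff n) ∧
      g.support ⊆ B.image (fun s : Sym (Fin 4) 3 => ((s : Multiset (Fin 4)).map d).sum) ∧
      (g.roots.toFinset.filter (fun x => 0 < x)).card + 1 = B.card := by
  set σ : Sym (Fin 4) 3 → ℕ := fun s => ((s : Multiset (Fin 4)).map d).sum with hσ
  set A := ((Finset.univ : Finset (Sym (Fin 4) 3)).erase (Sym.replicate 3 3)).erase (Sym.replicate 3 0) with hA
  set K := A \ B with hK
  set f := Matrix.det (∑ l, ((X : ℝ[X]) ^ d l) • (S l).map C) with hf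
  obtain ⟨g, hg, hZ⟩ := exists_iterTwist f ((K.image σ).image (fun m : ℕ => (m : ℝ)))
  have hsupp : g.support ⊆ B.image σ := by
    intro n hn
    have hn' := support_subset_sdiff_of_coeff_twists hg hn
    rcases Finset.mem_sdiff.mp hn' with ⟨hnf, hnK⟩
    obtain ⟨s, hs, hsn⟩ := Finset.mem_image.mp (support_det_pencil_subset_of_nullNull d S h0 h3 hnf)
    have hsK : s ∉ K := fun h => hnK (Finset.mem_image.mpr ⟨s, h, hsn⟩)
    have hsB : s ∈ B := by
      by_contra hne
      exact hsK (by rw [hK, Finset.mem_sdiff]; exact ⟨hs, hne⟩)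
    exact Finset.mem_image.mpr ⟨s, hsB, hsn⟩
  have hAcard : A.card = 18 := by
    have hne : Sym.replicate 3 (0 : Fin 4) ≠ Sym.replicate 3 3 := by decide
    rw [hA, Finset.card_erase_of_mem (Finset.mem_erase.mpr ⟨hne, Finset.mem_univ _⟩), Finset.card_erase_of_mem (Finset.mem_univ _),
      Finset.card_univ, Sym.card_sym_eq_choose]
    decide
  have hsplit : K.card + B.card = 18 := by
    rw [hK, Finset.card_sdiff_of_subset hB, hAcard]
    have hBle : B.card ≤ A.card := Finset.card_le_card hB
    omega
  have hU : ((K.image σ).image (fun m : ℕ => (m : ℝ))).card ≤ K.card := Finset.card_image_le.trans Finset.card_image_le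
  have hBpos : 1 ≤ B.card := Finset.card_pos.mpr hB0
  refine ⟨g, hg, hsupp, ?_⟩
  rcases eq_or_ne g 0 with hg0 | hg0
  · rw [hg0, roots_zero, Multiset.toFinset_zero, Finset.filter_empty, Finset.card_empty] at hZ ⊢
    omega
  · have hlt := Literature.Computability.AlgebraicComplexity.card_roots_toFinset_filter_pos_lt_card_support hg0
    have hcard : g.support.card ≤ B.card := (Finset.card_le_card hsupp).trans Finset.card_image_le
    omega

/-! ## 3. The top window made explicit: the top-trinomial inequality -/

/-- **TOP-TRINOMIAL INEQUALITY OF A NULL-TOP EIGHTEEN.**  Sorted support with gaps `d₁ = d₀ + a`, `d₂ = d₁ + b` (`a, b ≥ 1`), symmetric or not, `det S₃ = 0`,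
`18` distinct positive roots.  With `τ_e = tr(adj S₃·S_e)` (the top-block coefficients `c_{33e}`) and the twist weights
`W(n) = ∏ (n − σ(u))` over the `16` slots `u` outside the top block, the twisted top window `W(2d₃+d₀)τ₀·X^{2d₃+d₀} + W(2d₃+d₁)τ₁·X^{2d₃+d₁} + W(2d₃+d₂)τ₂·X^{2d₃+d₂}`
has two distinct positive roots, so `(a+b)^{a+b} |W(2d₃+d₀)τ₀|^b |W(2d₃+d₂)τ₂|^a ≤ |W(2d₃+d₁)τ₁|^{a+b} aᵃ bᵇ`. [folklore] -/
theorem topTrinomial_ineq_of_nullTop_eighteen (d : Fin 4 → ℕ) (hd : StrictMono d) (S : Fin 4 → Matrix (Fin 3) (Fin 3) ℝ) (h3 : (S 3).det = 0)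
    (h18 : 18 ≤ ((Matrix.det (∑ l, ((X : ℝ[X]) ^ d l) • (S l).map C)).roots.toFinset.filter (fun t => 0 < t)).card)
    {a b : ℕ} (ha : d 1 = d 0 + a) (hb : d 2 = d 1 + b)
    (W : ℕ → ℝ) (hW : ∀ n, W n =
      ∏ E ∈ ((((Finset.univ : Finset (Sym (Fin 4) 3)).erase (Sym.replicate 3 3)).filter
          (fun s : Sym (Fin 4) 3 => Multiset.count 3 (s : Multiset (Fin 4)) ≠ 2)).image
          (fun s : Sym (Fin 4) 3 => ((s : Multiset (Fin 4)).map d).sum)).image (fun m : ℕ => (m : ℝ)), ((n : ℝ) - E)) :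
    ((a : ℝ) + b) ^ (a + b) * |W (2 * d 3 + d 0) * ((S 3).adjugate * S 0).trace| ^ b * |W (2 * d 3 + d 2) * ((S 3).adjugate * S 2).trace| ^ a
      ≤ |W (2 * d 3 + d 1) * ((S 3).adjugate * S 1).trace| ^ (a + b) * (a : ℝ) ^ a * (b : ℝ) ^ b := by
  have ha0 : 0 < a := by have := hd (show (0 : Fin 4) < 1 by decide); omega
  have hb0 : 0 < b := by have := hd (show (1 : Fin 4) < 2 by decide); omega
  obtain ⟨g, hg, hsupp, hZ⟩ := twistedBlock_sharp_of_nullTop_eighteen d S h3 h18 2 (by norm_num)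
  have hcardB : ((Finset.univ : Finset (Sym (Fin 4) 3)).filter (fun s : Sym (Fin 4) 3 => Multiset.count 3 (s : Multiset (Fin 4)) = 2)).card = 3 := by
    rw [topSlots_eq]; decide
  rw [hcardB] at hZ
  -- the top block's exponents
  have hmemB : ∀ n ∈ g.support, n = 2 * d 3 + d 0 ∨ n = 2 * d 3 + d 1 ∨ n = 2 * d 3 + d 2 := by
    intro n hn
    have h := hsupp hn
    rw [topSlots_eq] at h
    simp only [Finset.image_insert, Finset.image_singleton, Finset.mem_insert, Finset.mem_singleton, Sym.coe_mk,
      Multiset.insert_eq_cons, Multiset.map_cons, Multiset.sum_cons, Multiset.map_singleton, Multiset.sum_singleton] at h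
    omega
  -- coefficients of `g` on the top block
  have hcoef : ∀ e : Fin 4, e ≠ 3 → g.coeff (2 * d 3 + d e) = W (2 * d 3 + d e) * ((S 3).adjugate * S e).trace := by
    intro e he
    rw [hg, hW, (coeff_square_of_nullTop_eighteen d hd S h3 h18 3 e (Ne.symm he)).1]
  -- `g` is the trinomial
  have hdist01 : 2 * d 3 + d 0 ≠ 2 * d 3 + d 1 := by omega
  have hdist02 : 2 * d 3 + d 0 ≠ 2 * d 3 + d 2 := by omega
  have hdist12 : 2 * d 3 + d 1 ≠ 2 * d 3 + d 2 := by omega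
  have hgeq : g = C (W (2 * d 3 + d 0) * ((S 3).adjugate * S 0).trace) * X ^ (2 * d 3 + d 0)
      + C (W (2 * d 3 + d 1) * ((S 3).adjugate * S 1).trace) * X ^ (2 * d 3 + d 0 + a)
      + C (W (2 * d 3 + d 2) * ((S 3).adjugate * S 2).trace) * X ^ (2 * d 3 + d 0 + a + b) := by
    have e1 : 2 * d 3 + d 0 + a = 2 * d 3 + d 1 := by omega
    have e2 : 2 * d 3 + d 1 + b = 2 * d 3 + d 2 := by omega
    rw [e1, e2]
    ext n
    simp only [coeff_add, coeff_C_mul, coeff_X_pow]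
    by_cases h0 : n = 2 * d 3 + d 0
    · subst h0; rw [hcoef 0 (by decide), if_pos rfl, if_neg hdist01, if_neg hdist02]; ring
    by_cases h1 : n = 2 * d 3 + d 1
    · subst h1; rw [hcoef 1 (by decide), if_neg (Ne.symm hdist01), if_pos rfl, if_neg hdist12]; ring
    by_cases h2 : n = 2 * d 3 + d 2
    · subst h2; rw [hcoef 2 (by decide), if_neg (Ne.symm hdist02), if_neg (Ne.symm hdist12), if_pos rfl]; ring
    have hn : n ∉ g.support := fun hn => by rcases hmemB n hn with h | h | h <;> contradiction
    rw [notMem_support_iff.mp hn, if_neg h0, if_neg h1, if_neg h2]; ring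
  have h2 : 1 < ((C (W (2 * d 3 + d 0) * ((S 3).adjugate * S 0).trace) * X ^ (2 * d 3 + d 0)
      + C (W (2 * d 3 + d 1) * ((S 3).adjugate * S 1).trace) * X ^ (2 * d 3 + d 0 + a)
      + C (W (2 * d 3 + d 2) * ((S 3).adjugate * S 2).trace) * X ^ (2 * d 3 + d 0 + a + b)).roots.toFinset.filter
        (fun x => 0 < x)).card := by
    rw [← hgeq]; omega
  exact trinomial_two_posRoots_le ha0 hb0 _ _ _ h2

/-! ## 4. Bookkeeping: the Newton cone on the sheet -/

/-- **NEWTON CONE OF A NULL-TOP EIGHTEEN.**  With `det S₃ = 0` the determinant has at most `19` monomials; `18` distinct positive roots make it Descartes-sharp,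
so every triple `p < q < r` of its exponents satisfies the kernel Newton-cone inequality `A_p^{r−q}·A_r^{q−p} ≤ A_q^{r−p}`,
`A_n = |c_n|·∏_{u ≠ n} |n − u|` (`newton_cone_coeff`). [folklore] -/
theorem newton_cone_of_nullTop_eighteen (d : Fin 4 → ℕ) (S : Fin 4 → Matrix (Fin 3) (Fin 3) ℝ) (h3 : (S 3).det = 0)
    (h18 : 18 ≤ ((Matrix.det (∑ l, ((X : ℝ[X]) ^ d l) • (S l).map C)).roots.toFinset.filter (fun t => 0 < t)).card)
    {p q r : ℕ} (hp : p ∈ (Matrix.det (∑ l, ((X : ℝ[X]) ^ d l) • (S l).map C)).support)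
    (hq : q ∈ (Matrix.det (∑ l, ((X : ℝ[X]) ^ d l) • (S l).map C)).support)
    (hr : r ∈ (Matrix.det (∑ l, ((X : ℝ[X]) ^ d l) • (S l).map C)).support) (hpq : p < q) (hqr : q < r) :
    let P := Matrix.det (∑ l, ((X : ℝ[X]) ^ d l) • (S l).map C)
    (|P.coeff p| * ∏ u ∈ P.support.erase p, |(p : ℝ) - u|) ^ (r - q) *
        (|P.coeff r| * ∏ u ∈ P.support.erase r, |(r : ℝ) - u|) ^ (q - p)
      ≤ (|P.coeff q| * ∏ u ∈ P.support.erase q, |(q : ℝ) - u|) ^ (r - p) :=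
  newton_cone_coeff _ ((card_support_le_19_of_nullTop d S h3).trans (by omega)) hp hq hr hpq hqr


/-! ## 5. Appended (g8): the same heredity for the crux format itself — a full-support NINETEEN -/

/-- **TWISTED SUB-WORDS OF A NINETEEN ARE DESCARTES-SHARP** (the `DoorA34` format, no stratum hypothesis): if a real `(3,4)` pencil has `19` distinct positive
det-roots then for EVERY non-empty set `B` of the `20` slots the twisted restriction to `B` (coefficients `c_s·∏_{u∉B}(σ s − σ u)`) has exactly `#B − 1` distinct
positive roots — e.g. the four blocks by multiplicity of the letter `3` are `(9, 5, 2, 0)`-sharp.  (Located, HOME/DOOR-A34-ENG2G8-REPORT.md §4: the definite-top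
seventeen on `(0,2,5,26)` IS block-sharp `(9,5,2)` with `V = 19` and only `17` roots — the condition is necessary, not sufficient.) [folklore] -/
theorem twistedSubword_sharp_of_nineteen (d : Fin 4 → ℕ) (S : Fin 4 → Matrix (Fin 3) (Fin 3) ℝ)
    (h19 : 19 ≤ ((Matrix.det (∑ l, ((X : ℝ[X]) ^ d l) • (S l).map C)).roots.toFinset.filter (fun t => 0 < t)).card)
    (B : Finset (Sym (Fin 4) 3)) (hB0 : B.Nonempty) :
    ∃ g : ℝ[X],
      (∀ n : ℕ, g.coeff n =
        (∏ E ∈ (((Finset.univ : Finset (Sym (Fin 4) 3)) \ B).image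
            (fun s : Sym (Fin 4) 3 => ((s : Multiset (Fin 4)).map d).sum)).image (fun m : ℕ => (m : ℝ)), ((n : ℝ) - E))
          * (Matrix.det (∑ l, ((X : ℝ[X]) ^ d l) • (S l).map C)).coeff n) ∧
      g.support ⊆ B.image (fun s : Sym (Fin 4) 3 => ((s : Multiset (Fin 4)).map d).sum) ∧
      (g.roots.toFinset.filter (fun x => 0 < x)).card + 1 = B.card := by
  set σ : Sym (Fin 4) 3 → ℕ := fun s => ((s : Multiset (Fin 4)).map d).sum with hσ
  set K := (Finset.univ : Finset (Sym (Fin 4) 3)) \ B with hK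
  set f := Matrix.det (∑ l, ((X : ℝ[X]) ^ d l) • (S l).map C) with hf
  obtain ⟨g, hg, hZ⟩ := exists_iterTwist f ((K.image σ).image (fun m : ℕ => (m : ℝ)))
  have hsupp : g.support ⊆ B.image σ := by
    intro n hn
    have hn' := support_subset_sdiff_of_coeff_twists hg hn
    rcases Finset.mem_sdiff.mp hn' with ⟨hnf, hnK⟩
    obtain ⟨s, -, hsn⟩ := Finset.mem_image.mp (StubDescartesCeiling.support_det_pencil_subset d S hnf)
    have hsK : s ∉ K := fun h => hnK (Finset.mem_image.mpr ⟨s, h, hsn⟩)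
    have hsB : s ∈ B := by
      by_contra hne
      exact hsK (by rw [hK, Finset.mem_sdiff]; exact ⟨Finset.mem_univ _, hne⟩)
    exact Finset.mem_image.mpr ⟨s, hsB, hsn⟩
  have hU20 : (Finset.univ : Finset (Sym (Fin 4) 3)).card = 20 := by
    rw [Finset.card_univ, Sym.card_sym_eq_choose]; decide
  have hsplit : K.card + B.card = 20 := by
    have hBle : B.card ≤ 20 := hU20 ▸ Finset.card_le_card (Finset.subset_univ B)
    rw [hK, Finset.card_sdiff_of_subset (Finset.subset_univ B), hU20]
    omega
  have hU : ((K.image σ).image (fun m : ℕ => (m : ℝ))).card ≤ K.card := Finset.card_image_le.trans Finset.card_image_le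
  have hBpos : 1 ≤ B.card := Finset.card_pos.mpr hB0
  refine ⟨g, hg, hsupp, ?_⟩
  rcases eq_or_ne g 0 with hg0 | hg0
  · rw [hg0, roots_zero, Multiset.toFinset_zero, Finset.filter_empty, Finset.card_empty] at hZ ⊢
    omega
  · have hlt := Literature.Computability.AlgebraicComplexity.card_roots_toFinset_filter_pos_lt_card_support hg0
    have hcard : g.support.card ≤ B.card := (Finset.card_le_card hsupp).trans Finset.card_image_le
    omega

end Summit.ValiantsHypothesis.ValiantsHypothesis.Theorems.LacunarySymmetroidMatrixDescartes.Census
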